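import Summits.Ventures.Crystal3D.Theorems.StickyWulffConstantStackingLiminfRefinedProfile
import Summits.Ventures.Crystal3D.Theorems.StickyWulffConstantStackingLiminfRefinedArith
import HarnessLib

/-!
# A word-uniform surface rung with constant `∛320`: clusters on ANY Barlow stacking have
# `≥ ∛320·N^{2/3} − (4/5)√N` missing bonds (`∛320 = 4∛5 = 6.84 = 90.5 %` of `∛432`)

Route `StickyWulffConstant`, crux `StackingLiminf` (stmt-Ventures-19145), cell `crystal3d-full`.
HONEST FRAMING: on-lattice, uniform in the Hägg word, NON-sharp (the crux asserts `∛432 − ε`);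
it improves the session's `∛243` rung (`…UniformBound.lean`) by charging, besides the terraces,
the LATERAL cost of interfaces between layers of comparable size.

**Theorem** (`numContacts_le_of_mem_barlowStacking_cbrt320`): for every Hägg word `σ` and every
injective `x : Fin N → ℝ³` on `barlowStacking 1 √(2/3) σ`,
`numContacts x ≤ 6N − min(3N/5, ∛320·N^{2/3} − (4/5)√N)`; hence (`stackingLiminf_rung_cbrt320`)
for every `ε > 0`, eventually and uniformly in `σ`, `(∛320 − ε)N^{2/3} ≤ 6N − numContacts x`.

**Proof.** By `layerProfile` the deficiency is `∑_layers d(κ) + ∑_interfaces b(κ)` with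
`d(κ)² + 3 ≥ 12n(κ)` and `b(κ) ≥ max((3/2)|Δ|, (1/2)|Δ| + √max)` (`Δ = n(κ) − n(κ+1)`).  Let
`M = max n`.  If `M ≤ 30`, already `∑ d ≥ (N/M)√(12M − 3) ≥ 3N/5`.  If `M ≥ 31`, the calibration
`(θ, Ψ, Ψ₂)` with `a = 16M/25` (`…RefinedArith.lean`) turns each interface bound into
`b ≥ Ψ₂(n(κ))/2 + Ψ₂(n(κ+1))/2 + |G(n(κ+1)) − G(n(κ))|`; summing, the `Ψ₂`-halves collect to
`∑_layers Ψ₂(n)` and the total variation of `G ∘ n` (which vanishes at both ends and reaches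
`G(M)`) gives `2G(M) = (66/25)M − (4/5)√M`; per layer `d + Ψ₂(n) ≥ (17/4)n/√M`; so the deficiency
is `≥ (17/4)N/√M + (66/25)M − (4/5)√M ≥ ∛(27·(17/4)²·(66/25)/4)·N^{2/3} − (4/5)√N`, and
`27·(17/4)²·(66/25)/4 = 321.87… ≥ 320`.

WHAT THIS IS NOT: not `StackingLiminf`; nothing about which stacking is optimal; F-C1 not moved.
-/

noncomputable section

namespace Summit.Ventures.Crystal3D.Theorems

open Finset
open Literature.MathematicalPhysics.StatisticalMechanics (barlowStacking IsHaggSeq)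

/-- `(12n − 3)M² ≥ n²(12M − 3)` for `1 ≤ n ≤ M`: the concavity step `√(12n−3) ≥ (n/M)√(12M−3)`. -/
theorem sqrt_layer_ge {n M d : ℝ} (hn1 : 1 ≤ n) (hnM : n ≤ M) (hd0 : 0 ≤ d)
    (hd : 12 * n ≤ d ^ 2 + 3) : n * Real.sqrt (12 * M - 3) / M ≤ d := by
  have hM0 : 0 < M := by linarith
  have ht0 : 0 ≤ Real.sqrt (12 * M - 3) := Real.sqrt_nonneg _
  have ht2 : Real.sqrt (12 * M - 3) ^ 2 = 12 * M - 3 := Real.sq_sqrt (by linarith)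
  have hsq : (n * Real.sqrt (12 * M - 3) / M) ^ 2 ≤ d ^ 2 := by
    rw [div_pow, mul_pow, ht2, div_le_iff₀ (by positivity)]
    have hkey : n ^ 2 * (12 * M - 3) ≤ (12 * n - 3) * M ^ 2 := by
      nlinarith [mul_nonneg (sub_nonneg.2 hnM) (by nlinarith : (0 : ℝ) ≤ 4 * n * M - M - n)]
    nlinarith
  exact (pow_le_pow_iff_left₀ (by positivity) hd0 two_ne_zero).1 hsq

/-- `∛320·N^{2/3} ≤ 3N/5` for `N ≥ 1482` (cube both sides: `320N² ≤ 27N³/125`). -/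
theorem cbrt320_rpow_le {N : ℝ} (hN : 1482 ≤ N) :
    (320 : ℝ) ^ ((1 : ℝ) / 3) * N ^ ((2 : ℝ) / 3) ≤ 3 / 5 * N := by
  have hN0 : 0 ≤ N := by linarith
  have h1 : ((320 : ℝ) ^ ((1 : ℝ) / 3) * N ^ ((2 : ℝ) / 3)) ^ 3 = 320 * N ^ 2 := by
    rw [mul_pow, ← Real.rpow_natCast, ← Real.rpow_natCast (N ^ ((2 : ℝ) / 3)),
      ← Real.rpow_mul (by norm_num), ← Real.rpow_mul hN0]
    norm_num
  have h2 : 320 * N ^ 2 ≤ (3 / 5 * N) ^ 3 := by nlinarith [sq_nonneg N]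
  rw [← h1] at h2
  exact (pow_le_pow_iff_left₀ (by positivity) (by positivity) (by norm_num : (3 : ℕ) ≠ 0)).1 h2

/-- **The real-analysis assembly.**  From the data of `layerProfile` (any `C` with
`C + ∑ d + ∑ b ≤ 6N`): `C ≤ 6N − min(3N/5, ∛320·N^{2/3} − (4/5)√N)`. -/
theorem profile_bound {N : ℕ} (hN : 0 < N) {C : ℝ} {kmin kmax : ℤ} {n : ℤ → ℕ} {d b : ℤ → ℝ}
    (hkk : kmin ≤ kmax) (hsupp : ∀ κ, n κ ≠ 0 → kmin ≤ κ ∧ κ ≤ kmax)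
    (hsum : ∑ κ ∈ Finset.Icc kmin kmax, n κ = N) (hd0 : ∀ κ, n κ = 0 → d κ = 0)
    (hd : ∀ κ, 0 ≤ d κ ∧ 12 * (n κ : ℝ) ≤ d κ ^ 2 + 3)
    (hb1 : ∀ κ, 3 / 2 * |(n κ : ℝ) - n (κ + 1)| ≤ b κ)
    (hb2 : ∀ κ, 1 / 2 * |(n κ : ℝ) - n (κ + 1)| + Real.sqrt (max (n κ : ℝ) (n (κ + 1))) ≤ b κ)
    (hC : C + ∑ κ ∈ Finset.Icc kmin kmax, d κ + ∑ κ ∈ Finset.Icc (kmin - 1) kmax, b κ ≤ 6 * N) :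
    C ≤ 6 * N -
      min (3 / 5 * (N : ℝ)) ((320 : ℝ) ^ ((1 : ℝ) / 3) * (N : ℝ) ^ ((2 : ℝ) / 3)
        - 4 / 5 * Real.sqrt N) := by
  set Λ := Finset.Icc kmin kmax with hΛ
  set I := Finset.Icc (kmin - 1) kmax with hI
  have hΛne : Λ.Nonempty := ⟨kmin, mem_Icc.2 ⟨le_rfl, hkk⟩⟩
  -- the largest layer
  obtain ⟨κ₀, hκ₀Λ, hκ₀⟩ := exists_max_image Λ n hΛne
  obtain ⟨M, hMdef⟩ : ∃ M : ℕ, n κ₀ = M := ⟨_, rfl⟩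
  have hnM : ∀ κ, n κ ≤ M := by
    intro κ
    by_cases hκ : κ ∈ Λ
    · exact hMdef ▸ hκ₀ κ hκ
    · have : n κ = 0 := by
        by_contra h
        exact hκ (mem_Icc.2 (hsupp κ h))
      simp [this]
  have hMN : M ≤ N := by
    rw [← hMdef, ← hsum]
    exact single_le_sum (fun κ _ => Nat.zero_le (n κ)) hκ₀Λ
  have hM1 : 1 ≤ M := by
    by_contra hM0
    have hz : ∀ κ ∈ Λ, n κ = 0 := fun κ _ => by have := hnM κ; omega
    have : ∑ κ ∈ Λ, n κ = 0 := sum_eq_zero hz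
    omega
  have hM1r : (1 : ℝ) ≤ M := by exact_mod_cast hM1
  have hMNr : (M : ℝ) ≤ N := by exact_mod_cast hMN
  have hNr : (1 : ℝ) ≤ N := hM1r.trans hMNr
  -- the interface terms are nonnegative
  have hb0 : ∀ κ, 0 ≤ b κ := fun κ => le_trans (by positivity) (hb1 κ)
  have hsumb0 : 0 ≤ ∑ κ ∈ I, b κ := sum_nonneg fun κ _ => hb0 κ
  -- in-layer, through concavity: `∑ d ≥ (N/M)·√(12M − 3)`
  have hsum_r : ∑ κ ∈ Λ, (n κ : ℝ) = N := by exact_mod_cast hsum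
  have hdsum : (N : ℝ) * Real.sqrt (12 * M - 3) / M ≤ ∑ κ ∈ Λ, d κ := by
    have hper : ∀ κ ∈ Λ, (n κ : ℝ) * Real.sqrt (12 * M - 3) / M ≤ d κ := by
      intro κ _
      by_cases hκ : n κ = 0
      · rw [hκ, hd0 κ hκ]; simp
      · exact sqrt_layer_ge (by exact_mod_cast Nat.pos_of_ne_zero hκ)
          (by exact_mod_cast hnM κ) (hd κ).1 (hd κ).2
    calc (N : ℝ) * Real.sqrt (12 * M - 3) / M
        = ∑ κ ∈ Λ, (n κ : ℝ) * Real.sqrt (12 * M - 3) / M := by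
          rw [← sum_div, ← sum_mul, hsum_r]
      _ ≤ ∑ κ ∈ Λ, d κ := sum_le_sum hper
  rcases le_or_gt (M : ℝ) 30 with hM30 | hM31
  · -- few balls per layer: `∑ d ≥ 3N/5`
    have ht : 3 / 5 * (M : ℝ) ≤ Real.sqrt (12 * M - 3) := by
      have h := Real.sqrt_le_sqrt (show (3 / 5 * (M : ℝ)) ^ 2 ≤ 12 * M - 3 by nlinarith)
      rwa [Real.sqrt_sq (by positivity)] at h
    have h35 : 3 / 5 * (N : ℝ) ≤ ∑ κ ∈ Λ, d κ := by
      refine le_trans ?_ hdsum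
      rw [le_div_iff₀ (by linarith)]
      nlinarith
    have := min_le_left (3 / 5 * (N : ℝ))
      ((320 : ℝ) ^ ((1 : ℝ) / 3) * (N : ℝ) ^ ((2 : ℝ) / 3) - 4 / 5 * Real.sqrt N)
    linarith
  · -- large layers: calibration
    have hM31n : 31 ≤ M := by
      have : (30 : ℝ) < (M : ℕ) := hM31
      have : 30 < M := by exact_mod_cast this
      omega
    have hM31' : (31 : ℝ) ≤ M := by exact_mod_cast hM31n
    set a : ℝ := 16 * M / 25 with ha
    have haM : a < M := by rw [ha]; linarith
    have ha0 : 0 ≤ a := by rw [ha]; positivity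
    have hsa : Real.sqrt a ≤ M - a := by rw [ha]; exact sqrt_a_le (by linarith)
    set θf : ℝ → ℝ := fun x => max (x - a) 0 / (M - a) with hθ
    set Ψf : ℝ → ℝ := fun x => (max (x - a) 0) ^ 2 / (2 * (M - a)) with hΨ
    set Ψ₂f : ℝ → ℝ := fun x => Real.sqrt a * (max (x - a) 0 / (M - a)) with hΨ₂
    set Gf : ℝ → ℝ := fun x => 3 / 2 * x - Ψf x - Ψ₂f x / 2 with hG
    have hΨ₂0 : ∀ x, 0 ≤ Ψ₂f x := fun x => mul_nonneg (Real.sqrt_nonneg _) (theta_nonneg haM x)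
    -- calibration at every interface
    have hcal : ∀ κ, Ψ₂f (n κ) / 2 + Ψ₂f (n (κ + 1)) / 2 + |Gf (n κ) - Gf (n (κ + 1))| ≤ b κ := by
      intro κ
      have h := interface_calibration (c := 1) (M := (M : ℝ)) (p := (n κ : ℝ))
        (q := (n (κ + 1) : ℝ)) (β := b κ) (θ := θf) (Ψ := Ψf) (Ψ₂ := Ψ₂f) zero_le_one
        (Nat.cast_nonneg _) (Nat.cast_nonneg _) (by exact_mod_cast hnM κ)
        (by exact_mod_cast hnM (κ + 1)) (fun x _ => theta_nonneg haM x)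
        (fun x hx => theta_le_one haM hx) (fun x y _ hxy => theta_mul_le_psi_sub haM hxy)
        (fun x _ => sqrt_mul_theta_le haM) (fun x y _ hxy hyM => G_mono haM hsa hxy hyM)
        (hb1 κ) (by simpa only [one_mul] using hb2 κ)
      simpa only [hG] using h
    have hsum_cal : ∑ κ ∈ I, (Ψ₂f (n κ) / 2 + Ψ₂f (n (κ + 1)) / 2 + |Gf (n κ) - Gf (n (κ + 1))|)
        ≤ ∑ κ ∈ I, b κ := sum_le_sum fun κ _ => hcal κ
    -- the `Ψ₂`-halves collect to `∑_Λ Ψ₂(n)`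
    have hΛI : Λ ⊆ I := Icc_subset_Icc (by linarith) le_rfl
    have hi : ∑ κ ∈ Λ, Ψ₂f (n κ) ≤ ∑ κ ∈ I, Ψ₂f (n κ) :=
      sum_le_sum_of_subset_of_nonneg hΛI fun κ _ _ => hΨ₂0 _
    have hii : ∑ κ ∈ Λ, Ψ₂f (n κ) ≤ ∑ κ ∈ I, Ψ₂f (n (κ + 1)) := by
      have e : ∑ κ ∈ I, Ψ₂f (n (κ + 1)) =
          ∑ κ ∈ Finset.Icc (kmin - 1 + 1) (kmax + 1), Ψ₂f (n κ) := by
        rw [← Finset.map_add_right_Icc, Finset.sum_map]; rfl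
      rw [e, sub_add_cancel]
      exact sum_le_sum_of_subset_of_nonneg (Icc_subset_Icc le_rfl (by linarith)) fun κ _ _ => hΨ₂0 _
    -- the total variation of `G ∘ n` through the largest layer
    have htv : 66 / 25 * (M : ℝ) - 4 / 5 * Real.sqrt M ≤ ∑ κ ∈ I, |Gf (n κ) - Gf (n (κ + 1))| := by
      set L' : ℕ := (kmax - kmin + 2).toNat with hL'
      set g : ℕ → ℝ := fun j => Gf (n (kmin - 1 + j)) with hg
      have hre : ∑ κ ∈ I, |Gf (n κ) - Gf (n (κ + 1))| =
          ∑ j ∈ Finset.range L', |g (j + 1) - g j| := by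
        refine Finset.sum_nbij' (fun κ => (κ - (kmin - 1)).toNat) (fun j => kmin - 1 + (j : ℤ))
          ?_ ?_ ?_ ?_ ?_
        · intro κ hκ; have := mem_Icc.1 hκ; rw [Finset.mem_range]; omega
        · intro j hj; rw [Finset.mem_range] at hj; rw [mem_Icc]; omega
        · intro κ hκ; have := mem_Icc.1 hκ; omega
        · intro j hj; omega
        · intro κ hκ
          have hκ' := mem_Icc.1 hκ
          have e1 : kmin - 1 + (((κ - (kmin - 1)).toNat : ℕ) : ℤ) = κ := by omega
          have e2 : kmin - 1 + (((κ - (kmin - 1)).toNat + 1 : ℕ) : ℤ) = κ + 1 := by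
            push_cast; omega
          simp only [hg, e1, e2]
          exact abs_sub_comm _ _
      rw [hre]
      have hj₀ : (κ₀ - (kmin - 1)).toNat ≤ L' := by have := mem_Icc.1 hκ₀Λ; omega
      have hGf0 : Gf 0 = 0 := by simp only [hG, hΨ, hΨ₂]; exact G_zero ha0
      have hg0 : g 0 = 0 := by
        have hn0 : n (kmin - 1) = 0 := by
          by_contra h; have := (hsupp _ h).1; omega
        simp only [hg, Nat.cast_zero, add_zero, hn0]; exact hGf0
      have hgL : g L' = 0 := by
        have hnL : n (kmin - 1 + L') = 0 := by
          by_contra h; have := (hsupp _ h).2; omega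
        simp only [hg, hnL, Nat.cast_zero]; exact hGf0
      have hgj : g ((κ₀ - (kmin - 1)).toNat) = 3 / 2 * M - (M - a) / 2 - Real.sqrt a / 2 := by
        have e1 : kmin - 1 + (((κ₀ - (kmin - 1)).toNat : ℕ) : ℤ) = κ₀ := by
          have := mem_Icc.1 hκ₀Λ; omega
        simp only [hg, e1, hMdef]; simp only [hG, hΨ, hΨ₂]; exact G_top haM
      have htv' := two_mul_le_sum_abs_sub g hj₀ hg0 hgL
      rw [hgj] at htv'
      have e3 := two_mul_G_top (M := (M : ℝ)) (by linarith)
      rw [ha] at htv'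
      linarith
    -- per layer: `d + Ψ₂(n) ≥ (17/4) n / √M`
    have hW : 17 / 4 * (N : ℝ) / Real.sqrt M ≤ ∑ κ ∈ Λ, (d κ + Ψ₂f (n κ)) := by
      have hper : ∀ κ ∈ Λ, 17 / 4 * (n κ : ℝ) / Real.sqrt M ≤ d κ + Ψ₂f (n κ) := by
        intro κ _
        by_cases hκ : n κ = 0
        · rw [hd0 κ hκ, hκ]; simp only [Nat.cast_zero, mul_zero, zero_div, zero_add]
          exact hΨ₂0 _
        · have hn1 : (1 : ℝ) ≤ n κ := by exact_mod_cast Nat.pos_of_ne_zero hκ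
          have hdsq : Real.sqrt (12 * n κ - 3) ≤ d κ := by
            have h := Real.sqrt_le_sqrt (show 12 * (n κ : ℝ) - 3 ≤ d κ ^ 2 by linarith [(hd κ).2])
            rwa [Real.sqrt_sq (hd κ).1] at h
          have hw : 17 / 4 * (n κ : ℝ) / Real.sqrt M ≤ Real.sqrt (12 * n κ - 3) + Ψ₂f (n κ) := by
            simpa only [hΨ₂, ha] using omega_mul_div_sqrt_le hM31' hn1 (by exact_mod_cast hnM κ)
          linarith
      calc 17 / 4 * (N : ℝ) / Real.sqrt M = ∑ κ ∈ Λ, 17 / 4 * (n κ : ℝ) / Real.sqrt M := by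
            rw [← sum_div, ← mul_sum, hsum_r]
        _ ≤ _ := sum_le_sum hper
    -- assemble
    have hAM := rpow_le_div_sqrt_add_mul (N := (N : ℝ)) (M := (M : ℝ)) (ω := 17 / 4)
      (β := 66 / 25) (by positivity) (by linarith) (by norm_num) (by norm_num)
    have h320 : (320 : ℝ) ^ ((1 : ℝ) / 3) * (N : ℝ) ^ ((2 : ℝ) / 3) ≤
        (27 * (17 / 4 : ℝ) ^ 2 * (66 / 25) / 4) ^ ((1 : ℝ) / 3) * (N : ℝ) ^ ((2 : ℝ) / 3) :=
      mul_le_mul_of_nonneg_right (Real.rpow_le_rpow (by norm_num) (by norm_num) (by norm_num))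
        (by positivity)
    have hsqrtMN : Real.sqrt M ≤ Real.sqrt N := Real.sqrt_le_sqrt hMNr
    have h1 : ∑ κ ∈ Λ, (d κ + Ψ₂f (n κ)) = ∑ κ ∈ Λ, d κ + ∑ κ ∈ Λ, Ψ₂f (n κ) := sum_add_distrib
    have h2 : ∑ κ ∈ I, (Ψ₂f (n κ) / 2 + Ψ₂f (n (κ + 1)) / 2 + |Gf (n κ) - Gf (n (κ + 1))|) =
        (∑ κ ∈ I, Ψ₂f (n κ)) / 2 + (∑ κ ∈ I, Ψ₂f (n (κ + 1))) / 2 +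
          ∑ κ ∈ I, |Gf (n κ) - Gf (n (κ + 1))| := by
      rw [sum_add_distrib, sum_add_distrib, sum_div, sum_div]
    have hmin := min_le_right (3 / 5 * (N : ℝ))
      ((320 : ℝ) ^ ((1 : ℝ) / 3) * (N : ℝ) ^ ((2 : ℝ) / 3) - 4 / 5 * Real.sqrt N)
    linarith

/-- **Word-uniform surface rung with constant `∛320`.** For a Hägg sequence `σ` and an injective
configuration `x : Fin N → ℝ³` on `barlowStacking 1 √(2/3) σ`:
`numContacts x ≤ 6N − min(3N/5, ∛320·N^{2/3} − (4/5)√N)`. -/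
theorem numContacts_le_of_mem_barlowStacking_cbrt320 (σ : ℤ → ℤ) (hσ : IsHaggSeq σ) {N : ℕ}
    (x : Fin N → EuclideanSpace ℝ (Fin 3)) (hx : Function.Injective x)
    (hmem : ∀ i, x i ∈ barlowStacking 1 (Real.sqrt (2 / 3)) σ) :
    (numContacts x : ℝ) ≤ 6 * (N : ℝ) -
      min (3 / 5 * (N : ℝ)) ((320 : ℝ) ^ ((1 : ℝ) / 3) * (N : ℝ) ^ ((2 : ℝ) / 3)
        - 4 / 5 * Real.sqrt N) := by
  rcases Nat.eq_zero_or_pos N with rfl | hNpos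
  · have h0 : numContacts x = 0 := by
      rw [numContacts, contactPairs, Finset.card_eq_zero, Finset.filter_eq_empty_iff]
      intro p; exact Fin.elim0 p.1
    rw [h0]; simp [Real.zero_rpow (by norm_num : (2 : ℝ) / 3 ≠ 0)]
  obtain ⟨kmin, kmax, n, d, b, hkk, hsupp, hsum, hd0, hd, hb1, hb2, hC⟩ :=
    layerProfile σ hσ x hx hmem hNpos
  exact profile_bound hNpos hkk hsupp hsum hd0 hd hb1 hb2 hC

/-- **The rung in the shape of the crux `StackingLiminf`** (stmt-Ventures-19145), with
`∛320 = 6.8399…` in place of `∛432 = 7.5595…`: for every `ε > 0` there is `N₀`, independent of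
the Hägg word, such that every injective `N`-point configuration (`N ≥ N₀`) on any Barlow
stacking has `(∛320 − ε) N^{2/3} ≤ 6N − numContacts`. -/
theorem stackingLiminf_rung_cbrt320 :
    ∀ ε : ℝ, 0 < ε → ∃ N₀ : ℕ, ∀ N : ℕ, N₀ ≤ N → ∀ σ : ℤ → ℤ, IsHaggSeq σ →
      ∀ x : Fin N → EuclideanSpace ℝ (Fin 3), Function.Injective x →
        (∀ i, x i ∈ barlowStacking 1 (Real.sqrt (2 / 3)) σ) →
          ((320 : ℝ) ^ ((1 : ℝ) / 3) - ε) * (N : ℝ) ^ ((2 : ℝ) / 3) ≤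
            6 * (N : ℝ) - (numContacts x : ℝ) := by
  intro ε hε
  obtain ⟨N₁, hN₁⟩ := exists_nat_ge ((1 / (5 * ε / 4)) ^ 6)
  refine ⟨max 1482 N₁, fun N hN σ hσ x hx hmem => ?_⟩
  have hmain := numContacts_le_of_mem_barlowStacking_cbrt320 σ hσ x hx hmem
  have hN1 : (1482 : ℝ) ≤ N := by exact_mod_cast (le_max_left _ _).trans hN
  have hN2 : (1 / (5 * ε / 4)) ^ 6 ≤ (N : ℝ) :=
    hN₁.trans (by exact_mod_cast (le_max_right _ _).trans hN)
  have hP : (0 : ℝ) ≤ (N : ℝ) ^ ((2 : ℝ) / 3) := by positivity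
  have hA := cbrt320_rpow_le hN1
  have hB := sqrt_le_eps_mul_rpow (by positivity : 0 < 5 * ε / 4) hN2
  rcases min_cases (3 / 5 * (N : ℝ))
      ((320 : ℝ) ^ ((1 : ℝ) / 3) * (N : ℝ) ^ ((2 : ℝ) / 3) - 4 / 5 * Real.sqrt N) with
    ⟨h, _⟩ | ⟨h, _⟩
  · rw [h] at hmain; nlinarith
  · rw [h] at hmain; nlinarith

end Summit.Ventures.Crystal3D.Theorems

end
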